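import Mathlib
import Summits.ValiantsHypothesis.ValiantsHypothesis.Theorems.BarrierLeverPartitionMinorsHitByVPHiddenStatesBallBlocks
import Summits.ValiantsHypothesis.ValiantsHypothesis.Theorems.BarrierLeverPartitionMinorsHitByVPHiddenStatesFacePoset

/-!
# Route BarrierLever — item `PartitionMinorsHitByVP` (stmt-ValiantsHypothesis-19717), line `hidden-states`:
# BALL-DIAGONAL V — the top block and the ROW-KERNEL THEOREM (PROOF-balldiagonal §2–3 assembled)

Helper file (`--supports stmt-ValiantsHypothesis-19717`; cell valiant-natproofs, rung V4, 𝒟-side door (c), registered line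
`Cruxes/PartitionMinorsHitByVP/Lines/hidden_states.lean` v8; prover seat val-np-p6 gen 13). Definition-free; closes NO item.

SETTING as in `…BallBlocks`: core `C`, non-core block `N = univ ∖ C`, the missing complex `𝔈` (subsets of `N` of size `≥ 2`, closed under
sub-faces of size `≥ 2`), faces `F : C ↪ 𝔈`, the σ-table entries, and a row-kernel vector `b` vanishing on the missing up-set
`{univ} ∪ {univ ∖ y : y ∈ N} ∪ {univ ∖ E : E ∈ 𝔈}`.

* `eq_or_eq_erase_of_cocard_lt_two`, `sum_powerset_cocard_lt_two` — the subsets of `C` of co-size `< 2`.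
* `topBlock_zero` — STEP B(ii) + STEP C: with `G(T) = b(C ⊔ T) + Σ_q b((C∖q) ⊔ T)`, the evaluations of `G` vanish at all `|I| ≤ n − 2`,
  so (translated Möbius inversion) `G(T) = P·Λ^{N∖T} + Σ_{z ∉ T} P_z·Λ^{(N∖z)∖T}`; reading this at `T = N, N∖z, N∖E` (where `b` vanishes)
  gives `P = Σ_q κ_q`, `P_z = −Σ_q κ_q [z ∈ F q]` and the `s × s` system `Σ_q κ_q B_E(q) = 0` (`E ∈ 𝔈`), killed by
  `facePoset_kernel` (p632306); hence `κ = 0`, `P = P_z = 0`, `G = 0`, and the blocks `C∖q` and `C` of `b` vanish.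
* **`rowKernel_zero`** — THE ROW-KERNEL THEOREM: `b = 0`. With `…BallBlocks.lowerBlocks_zero` this is the nonsingularity of the ball
  `B_{h−2}(h)` with the σ-table against every down-set of co-size `h + 1` (the cells are assembled in the sequel file).

WHAT THIS IS NOT: the linear algebra of the ball-diagonal theorem; the structure of co-size-`(h+1)` down-sets, the table and the diagonal
cells are in the sequel; nothing on crux 14610 or VP ≠ VNP.
-/

set_option linter.dupNamespace false

namespace Summit.ValiantsHypothesis.ValiantsHypothesis.Theorems.BarrierLever.HiddenStates

open Finset

noncomputable section

namespace BallDiag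

/-- A subset of `C` of co-size `< 2` is `C` or a co-singleton `C ∖ q`. -/
theorem eq_or_eq_erase_of_cocard_lt_two {α : Type*} [DecidableEq α] (C D : Finset α) (hDC : D ⊆ C)
    (hD : ¬ D.card + 2 ≤ C.card) : D = C ∨ ∃ q ∈ C, D = C.erase q := by
  have hsd : (C \ D).card = C.card - D.card := Finset.card_sdiff_of_subset hDC
  have hle := Finset.card_le_card hDC
  rcases Nat.lt_or_ge (C \ D).card 1 with h0 | h1
  · left
    have hz : (C \ D).card = 0 := by omega
    have : C \ D = ∅ := Finset.card_eq_zero.mp hz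
    exact Finset.Subset.antisymm hDC (Finset.sdiff_eq_empty_iff_subset.mp this)
  · right
    have h1' : (C \ D).card = 1 := by omega
    obtain ⟨q, hq⟩ := Finset.card_eq_one.mp h1'
    have hqmem : q ∈ C \ D := by rw [hq]; exact Finset.mem_singleton_self q
    refine ⟨q, (Finset.mem_sdiff.mp hqmem).1, ?_⟩
    ext x
    simp only [Finset.mem_erase]
    constructor
    · intro hxD
      refine ⟨?_, hDC hxD⟩
      rintro rfl
      exact (Finset.mem_sdiff.mp hqmem).2 hxD
    · rintro ⟨hxq, hxC⟩
      by_contra hxD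
      have : x ∈ C \ D := Finset.mem_sdiff.mpr ⟨hxC, hxD⟩
      rw [hq, Finset.mem_singleton] at this
      exact hxq this

/-- A sum over the subsets of `C` of co-size `< 2`. -/
theorem sum_powerset_cocard_lt_two {α : Type*} [DecidableEq α] (C : Finset α) (f : Finset α → ℂ) :
    ∑ D ∈ C.powerset with ¬ D.card + 2 ≤ C.card, f D = f C + ∑ q ∈ C, f (C.erase q) := by
  have hset : C.powerset.filter (fun D => ¬ D.card + 2 ≤ C.card) = insert C (C.image fun q => C.erase q) := by
    ext D
    simp only [Finset.mem_filter, Finset.mem_powerset, Finset.mem_insert, Finset.mem_image]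
    constructor
    · rintro ⟨hDC, hD⟩
      rcases eq_or_eq_erase_of_cocard_lt_two C D hDC hD with h' | ⟨q, hq, h'⟩
      · exact Or.inl h'
      · exact Or.inr ⟨q, hq, h'.symm⟩
    · rintro (rfl | ⟨q, hq, rfl⟩)
      · exact ⟨subset_refl _, by omega⟩
      · refine ⟨Finset.erase_subset q C, ?_⟩
        have := Finset.card_erase_add_one hq
        omega
  rw [hset, Finset.sum_insert, Finset.sum_image]
  · intro q hq q' hq' hqq
    exact Finset.erase_injOn C hq hq' hqq
  · intro hC
    obtain ⟨q, hq, hq'⟩ := Finset.mem_image.mp hC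
    have := Finset.card_erase_add_one hq
    rw [hq'] at this
    omega

/-- **STEP B(ii) + STEP C — THE TOP BLOCK.** See the module docstring. -/
theorem topBlock_zero (h : ℕ) (C N : Finset (Fin h)) (hN : N = Finset.univ \ C)
    (𝔈 : Finset (Finset (Fin h))) (h𝔈N : ∀ E ∈ 𝔈, E ⊆ N) (h𝔈2 : ∀ E ∈ 𝔈, 2 ≤ E.card)
    (hclosed : ∀ E ∈ 𝔈, ∀ G, G ⊆ E → 2 ≤ G.card → G ∈ 𝔈)
    (F : Fin h → Finset (Fin h)) (hF𝔈 : ∀ c ∈ C, F c ∈ 𝔈) (hFinj : ∀ c ∈ C, ∀ c' ∈ C, F c = F c' → c = c')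
    (b : Finset (Fin h) → ℂ) (hb_univ : b Finset.univ = 0) (hb_erase : ∀ y ∈ N, b (Finset.univ.erase y) = 0)
    (hb_E : ∀ E ∈ 𝔈, b (Finset.univ \ E) = 0)
    (hcol : ∀ J : Finset (Fin h), J.card + 2 ≤ h →
      ∑ S : Finset (Fin h), b S * ((if S ∩ C ⊆ J then 1 else 0) *
        ∏ a ∈ S \ C, ((if a ∈ J then (1 : ℂ) else 0) - (((J ∩ C).filter fun c => a ∈ F c).card : ℂ))) = 0) :
    (∀ q ∈ C, b (Finset.univ.erase q) = 0) ∧ ∀ T, T ⊆ N → b (C ∪ T) = 0 := by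
  have hmemN : ∀ x, x ∈ N ↔ x ∉ C := fun x => by simp [hN]
  have hsn : C.card + N.card = h := by
    rw [hN, Finset.card_sdiff_of_subset (Finset.subset_univ C), Finset.card_univ, Fintype.card_fin]
    have : C.card ≤ h := by simpa using Finset.card_le_univ C
    omega
  -- set identities
  have hCN : C ∪ N = Finset.univ := by
    ext x
    simp only [Finset.mem_union, Finset.mem_univ, iff_true, hmemN]
    exact em (x ∈ C)
  have hCNerase : ∀ z ∈ N, C ∪ N.erase z = Finset.univ.erase z := by
    intro z hz
    rw [← hCN]
    ext x
    simp only [Finset.mem_union, Finset.mem_erase]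
    constructor
    · rintro (hxC | ⟨hxz, hxN⟩)
      · refine ⟨?_, Or.inl hxC⟩
        rintro rfl
        exact (hmemN x).mp hz hxC
      · exact ⟨hxz, Or.inr hxN⟩
    · rintro ⟨hxz, hxC | hxN⟩
      · exact Or.inl hxC
      · exact Or.inr ⟨hxz, hxN⟩
  have hCNE : ∀ E, E ⊆ N → C ∪ (N \ E) = Finset.univ \ E := by
    intro E hEN
    rw [← hCN]
    ext x
    simp only [Finset.mem_union, Finset.mem_sdiff]
    constructor
    · rintro (hxC | ⟨hxN, hxE⟩)
      · exact ⟨Or.inl hxC, fun hxE => (hmemN x).mp (hEN hxE) hxC⟩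
      · exact ⟨Or.inr hxN, hxE⟩
    · rintro ⟨hxC | hxN, hxE⟩
      · exact Or.inl hxC
      · exact Or.inr ⟨hxN, hxE⟩
  -- opaque names: `d = Λ_C`, `κ q = b(univ ∖ q)`
  obtain ⟨d, hd⟩ : ∃ d : Fin h → ℂ, ∀ a, ((C.filter fun c => a ∈ F c).card : ℂ) = d a := ⟨_, fun _ => rfl⟩
  obtain ⟨κ, hκ⟩ : ∃ κ : Fin h → ℂ, ∀ q, b (Finset.univ.erase q) = κ q := ⟨_, fun _ => rfl⟩
  have hμ : ∀ q ∈ C, ∀ a, (((C.erase q).filter fun c => a ∈ F c).card : ℂ) = d a - (if a ∈ F q then 1 else 0) := by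
    intro q hq a
    rw [← hd a, Finset.filter_erase]
    by_cases haq : a ∈ F q
    · have hmem : q ∈ C.filter (fun c => a ∈ F c) := Finset.mem_filter.mpr ⟨hq, haq⟩
      rw [if_pos haq, ← Finset.card_erase_add_one hmem]
      push_cast
      ring
    · have hnm : q ∉ C.filter (fun c => a ∈ F c) := fun h' => haq (Finset.mem_filter.mp h').2
      rw [Finset.erase_eq_of_notMem hnm, if_neg haq, sub_zero]
  -- STEP B(i), restated with `μ_q = d − 1_{F q}`
  have hgq : ∀ q ∈ C, ∀ T, T ⊆ N →
      b (C.erase q ∪ T) = κ q * ∏ a ∈ N \ T, (d a - if a ∈ F q then 1 else 0) := by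
    intro q hq T hT
    rw [eraseBlock_eq h C N hN F b hcol q hq T hT, hκ, Finset.prod_congr rfl fun a _ => hμ q hq a]
  -- `G(T) = b(C ⊔ T) + Σ_q b((C∖q) ⊔ T)` and the family `𝒟₂ = {I ⊆ N : |I| + 2 ≤ |N|}`
  obtain ⟨G, hG⟩ : ∃ G : Finset (Fin h) → ℂ, ∀ T, b (C ∪ T) + ∑ q ∈ C, b (C.erase q ∪ T) = G T :=
    ⟨_, fun _ => rfl⟩
  have hGeval : ∀ I ∈ N.powerset.filter (fun A => A.card + 2 ≤ N.card), ∑ T ∈ N.powerset,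
      G T * ∏ a ∈ T, ((if a ∈ I then (1 : ℂ) else 0) - d a) = 0 := by
    intro I hI
    obtain ⟨hIN, hIcard⟩ := Finset.mem_filter.mp hI
    have hI' : I ⊆ N := Finset.mem_powerset.mp hIN
    have h1 := block_column_eq h C N hN F b hcol C I (subset_refl C) hI' (by omega)
    simp only [hd] at h1
    rw [Finset.filter_true_of_mem (fun D₀ hD₀ => Finset.mem_powerset.mp hD₀),
      ← Finset.sum_filter_add_sum_filter_not C.powerset (fun D₀ => D₀.card + 2 ≤ C.card)] at h1
    have hlow : ∑ D₀ ∈ C.powerset with D₀.card + 2 ≤ C.card, ∑ T ∈ N.powerset,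
        b (D₀ ∪ T) * ∏ a ∈ T, ((if a ∈ I then (1 : ℂ) else 0) - d a) = 0 := by
      refine Finset.sum_eq_zero fun D₀ hD₀ => ?_
      obtain ⟨hD₀C, hD₀card⟩ := Finset.mem_filter.mp hD₀
      refine Finset.sum_eq_zero fun T hT => ?_
      rw [lowerBlocks_zero h C N hN F b hcol D₀ hD₀C hD₀card T hT, zero_mul]
    rw [hlow, zero_add, sum_powerset_cocard_lt_two] at h1
    refine Eq.trans ?_ h1
    rw [Finset.sum_comm (s := C), ← Finset.sum_add_distrib]
    refine Finset.sum_congr rfl fun T _ => ?_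
    rw [← hG, add_mul, Finset.sum_mul]
  have h𝒟N : ∀ I ∈ N.powerset.filter (fun A => A.card + 2 ≤ N.card), I ⊆ N :=
    fun I hI => Finset.mem_powerset.mp (Finset.mem_filter.mp hI).1
  have hdown : ∀ I ∈ N.powerset.filter (fun A => A.card + 2 ≤ N.card), ∀ A, A ⊆ I →
      A ∈ N.powerset.filter (fun A => A.card + 2 ≤ N.card) := by
    intro I hI A hA
    obtain ⟨hIN, hIcard⟩ := Finset.mem_filter.mp hI
    have := Finset.card_le_card hA
    exact Finset.mem_filter.mpr ⟨Finset.mem_powerset.mpr (hA.trans (Finset.mem_powerset.mp hIN)), by omega⟩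
  have hzero := translate_eq_zero N _ h𝒟N hdown G d hGeval
  obtain ⟨G', hG'⟩ : ∃ G' : Finset (Fin h) → ℂ, ∀ A,
      (∑ T' ∈ N.powerset with A ⊆ T', G T' * ∏ a ∈ T' \ A, (-d a)) = G' A := ⟨_, fun _ => rfl⟩
  -- the translate of `G` is supported on `{N} ∪ {N ∖ z}`
  have hGT : ∀ T, T ⊆ N → G T = G' N * ∏ a ∈ N \ T, d a
      + ∑ z ∈ N \ T, G' (N.erase z) * ∏ a ∈ (N.erase z) \ T, d a := by
    intro T hT
    rw [translate_inversion N T hT G d]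
    simp only [hG']
    rw [Finset.sum_filter, ← Finset.sum_filter_add_sum_filter_not N.powerset (fun A => A.card + 2 ≤ N.card)]
    have hsmall : ∑ A ∈ N.powerset with A.card + 2 ≤ N.card,
        (if T ⊆ A then G' A * ∏ a ∈ A \ T, d a else 0) = 0 := by
      refine Finset.sum_eq_zero fun A hA => ?_
      rw [← hG' A, hzero A hA, zero_mul, ite_self]
    rw [hsmall, zero_add, sum_powerset_cocard_lt_two, if_pos hT, Finset.sdiff_eq_filter N T, Finset.sum_filter]
    congr 1
    refine Finset.sum_congr rfl fun z _ => ?_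
    have hiff : T ⊆ N.erase z ↔ z ∉ T := by
      constructor
      · intro h' hzT
        exact Finset.notMem_erase z N (h' hzT)
      · intro hzT x hx
        exact Finset.mem_erase.mpr ⟨fun hxz => hzT (hxz ▸ hx), hT hx⟩
    simp only [hiff]
  -- (E1) at `T = N`
  have hE1 : G' N = ∑ q ∈ C, κ q := by
    have h1 := hGT N (subset_refl N)
    rw [Finset.sdiff_self, Finset.prod_empty, mul_one, Finset.sum_empty, add_zero] at h1
    rw [← h1, ← hG N, hCN, hb_univ, zero_add]
    refine Finset.sum_congr rfl fun q hq => ?_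
    rw [hgq q hq N (subset_refl N), Finset.sdiff_self, Finset.prod_empty, mul_one]
  -- (E2) at `T = N ∖ z`
  have hE2 : ∀ z ∈ N, G' (N.erase z) = -∑ q ∈ C, κ q * (if z ∈ F q then 1 else 0) := by
    intro z hz
    have h1 := hGT (N.erase z) (Finset.erase_subset z N)
    have hs1 : N \ N.erase z = {z} := by
      ext x
      simp only [Finset.mem_sdiff, Finset.mem_erase, Finset.mem_singleton, not_and]
      constructor
      · rintro ⟨hxN, hx⟩
        by_contra hxz
        exact hx hxz hxN
      · rintro rfl
        exact ⟨hz, fun h' _ => h' rfl⟩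
    rw [hs1, Finset.prod_singleton, Finset.sum_singleton, Finset.sdiff_self, Finset.prod_empty, mul_one,
      ← hG, hCNerase z hz, hb_erase z hz, zero_add, hE1] at h1
    rw [Finset.sum_congr rfl fun q hq => by rw [hgq q hq (N.erase z) (Finset.erase_subset z N), hs1,
      Finset.prod_singleton]] at h1
    have h2 : ∑ q ∈ C, κ q * (d z - if z ∈ F q then 1 else 0)
        = (∑ q ∈ C, κ q) * d z - ∑ q ∈ C, κ q * (if z ∈ F q then 1 else 0) := by
      rw [Finset.sum_mul, ← Finset.sum_sub_distrib]
      exact Finset.sum_congr rfl fun q _ => by ring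
    rw [h2] at h1
    linear_combination -h1
  -- (E3) at `T = N ∖ E`: the face-poset system
  have hstar : ∀ E ∈ 𝔈, ∑ q ∈ C, κ q *
      ((∏ a ∈ E, (d a - if a ∈ F q then 1 else 0)) - (∏ a ∈ E, d a)
        + ∑ z ∈ E, (if z ∈ F q then (1 : ℂ) else 0) * ∏ a ∈ E.erase z, d a) = 0 := by
    intro E hE
    have hEN : E ⊆ N := h𝔈N E hE
    have h1 := hGT (N \ E) Finset.sdiff_subset
    rw [Finset.sdiff_sdiff_eq_self hEN] at h1
    have hs : ∀ z ∈ E, (N.erase z) \ (N \ E) = E.erase z := by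
      intro z hz
      ext x
      simp only [Finset.mem_sdiff, Finset.mem_erase, not_and, not_not]
      constructor
      · rintro ⟨⟨hxz, hxN⟩, hx⟩
        exact ⟨hxz, hx hxN⟩
      · rintro ⟨hxz, hxE⟩
        exact ⟨⟨hxz, hEN hxE⟩, fun _ => hxE⟩
    rw [Finset.sum_congr rfl fun z hz => by rw [hs z hz, hE2 z (hEN hz)], hE1, ← hG, hCNE E hEN, hb_E E hE,
      zero_add] at h1
    rw [Finset.sum_congr rfl fun q hq => by rw [hgq q hq (N \ E) Finset.sdiff_subset,
      Finset.sdiff_sdiff_eq_self hEN]] at h1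
    -- distribute the left-hand side of the goal
    have hexp : ∑ q ∈ C, κ q * ((∏ a ∈ E, (d a - if a ∈ F q then 1 else 0)) - (∏ a ∈ E, d a)
          + ∑ z ∈ E, (if z ∈ F q then (1 : ℂ) else 0) * ∏ a ∈ E.erase z, d a)
        = (∑ q ∈ C, κ q * ∏ a ∈ E, (d a - if a ∈ F q then 1 else 0)) - (∑ q ∈ C, κ q) * ∏ a ∈ E, d a
          + ∑ z ∈ E, (∑ q ∈ C, κ q * (if z ∈ F q then (1 : ℂ) else 0)) * ∏ a ∈ E.erase z, d a := by
      have h2 : ∀ q ∈ C, κ q * ((∏ a ∈ E, (d a - if a ∈ F q then 1 else 0)) - (∏ a ∈ E, d a)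
            + ∑ z ∈ E, (if z ∈ F q then (1 : ℂ) else 0) * ∏ a ∈ E.erase z, d a)
          = κ q * ∏ a ∈ E, (d a - if a ∈ F q then 1 else 0) - κ q * ∏ a ∈ E, d a
            + ∑ z ∈ E, κ q * (if z ∈ F q then (1 : ℂ) else 0) * ∏ a ∈ E.erase z, d a := by
        intro q _
        rw [mul_add, mul_sub, Finset.mul_sum]
        congr 1
        exact Finset.sum_congr rfl fun z _ => by ring
      rw [Finset.sum_congr rfl h2, Finset.sum_add_distrib, Finset.sum_sub_distrib, ← Finset.sum_mul, Finset.sum_comm]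
      congr 1
      exact Finset.sum_congr rfl fun z _ => by rw [Finset.sum_mul]
    rw [hexp, h1]
    have h3 : ∑ z ∈ E, -(∑ q ∈ C, κ q * (if z ∈ F q then (1 : ℂ) else 0)) * ∏ a ∈ E.erase z, d a
        + ∑ z ∈ E, (∑ q ∈ C, κ q * (if z ∈ F q then (1 : ℂ) else 0)) * ∏ a ∈ E.erase z, d a = 0 := by
      rw [← Finset.sum_add_distrib]
      exact Finset.sum_eq_zero fun z _ => by ring
    linear_combination h3
  -- STEP C
  have hκ0 : ∀ q ∈ C, κ q = 0 := facePoset_kernel C 𝔈 h𝔈2 hclosed F hF𝔈 hFinj d κ hstar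
  have hP : G' N = 0 := by
    rw [hE1]
    exact Finset.sum_eq_zero fun q hq => hκ0 q hq
  have hPz : ∀ z ∈ N, G' (N.erase z) = 0 := by
    intro z hz
    rw [hE2 z hz, neg_eq_zero]
    exact Finset.sum_eq_zero fun q hq => by rw [hκ0 q hq, zero_mul]
  refine ⟨fun q hq => by rw [hκ, hκ0 q hq], fun T hT => ?_⟩
  have hG0 : G T = 0 := by
    rw [hGT T hT, hP, zero_mul, zero_add]
    exact Finset.sum_eq_zero fun z hz => by rw [hPz z (Finset.mem_sdiff.mp hz).1, zero_mul]
  have h1 := hG T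
  rw [hG0] at h1
  have h2 : ∑ q ∈ C, b (C.erase q ∪ T) = 0 :=
    Finset.sum_eq_zero fun q hq => by rw [hgq q hq T hT, hκ0 q hq, zero_mul]
  linear_combination h1 - h2

/-- **THE ROW-KERNEL THEOREM** — the ball `B_{h−2}` on `h` states with the σ-table is nonsingular against every down-set of co-size
`h + 1` (kernel form: every row-kernel vector vanishes). See the module docstring. -/
theorem rowKernel_zero (h : ℕ) (C N : Finset (Fin h)) (hN : N = Finset.univ \ C)
    (𝔈 : Finset (Finset (Fin h))) (h𝔈N : ∀ E ∈ 𝔈, E ⊆ N) (h𝔈2 : ∀ E ∈ 𝔈, 2 ≤ E.card)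
    (hclosed : ∀ E ∈ 𝔈, ∀ G, G ⊆ E → 2 ≤ G.card → G ∈ 𝔈)
    (F : Fin h → Finset (Fin h)) (hF𝔈 : ∀ c ∈ C, F c ∈ 𝔈) (hFinj : ∀ c ∈ C, ∀ c' ∈ C, F c = F c' → c = c')
    (b : Finset (Fin h) → ℂ) (hb_univ : b Finset.univ = 0) (hb_erase : ∀ y ∈ N, b (Finset.univ.erase y) = 0)
    (hb_E : ∀ E ∈ 𝔈, b (Finset.univ \ E) = 0)
    (hcol : ∀ J : Finset (Fin h), J.card + 2 ≤ h →
      ∑ S : Finset (Fin h), b S * ((if S ∩ C ⊆ J then 1 else 0) *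
        ∏ a ∈ S \ C, ((if a ∈ J then (1 : ℂ) else 0) - (((J ∩ C).filter fun c => a ∈ F c).card : ℂ))) = 0) :
    ∀ S, b S = 0 := by
  obtain ⟨hκ0, htop⟩ := topBlock_zero h C N hN 𝔈 h𝔈N h𝔈2 hclosed F hF𝔈 hFinj b hb_univ hb_erase hb_E hcol
  intro S
  have hS : S = (S ∩ C) ∪ (S \ C) := by rw [Finset.union_comm, Finset.sdiff_union_inter]
  have hTN : S \ C ⊆ N := by rw [hN]; exact Finset.sdiff_subset_sdiff (Finset.subset_univ S) (subset_refl C)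
  by_cases hsmall : (S ∩ C).card + 2 ≤ C.card
  · rw [hS]
    exact lowerBlocks_zero h C N hN F b hcol (S ∩ C) (Finset.mem_powerset.mpr Finset.inter_subset_right) hsmall
      (S \ C) (Finset.mem_powerset.mpr hTN)
  · rcases eq_or_eq_erase_of_cocard_lt_two C (S ∩ C) Finset.inter_subset_right hsmall with hC | ⟨q, hq, hq'⟩
    · rw [hS, hC]
      exact htop (S \ C) hTN
    · rw [hS, hq', eraseBlock_eq h C N hN F b hcol q hq (S \ C) hTN, hκ0 q hq, zero_mul]

end BallDiag

end

end Summit.ValiantsHypothesis.ValiantsHypothesis.Theorems.BarrierLever.HiddenStates
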